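import Summits.QuantumFields.BalabanUV.Beta.FP.FixedPointIdentificationSummable

/-!
# `BalabanUV.Beta.FP.FixedPointIdentificationGeometric` — road «FP» for binder row D1: WHAT A GEOMETRIC-RATE ROW DELIVERS FOR A STEP DEFECT
# (or for any per-step ADDEND of the one-loop functional) — the defects CONVERGE to a limit `ℓ` with a summable transient, the identified value
# is SHIFTED BY EXACTLY `ℓ`, and «Σ-bounded step defect» holds IF AND ONLY IF `ℓ = 0` (supplier word W-gan24p3-g30-1 of the (CONV-C)-Sb chair, made
# a theorem; the owner's ERRATUM E-FP-15-3 withdrew R-FP-47 — (SDF) is EXACT under R-FP-45 (B) — and keeps this class of file as «harmless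
# generalisation»: it is the door for ANY per-step addend with a convergent, non-summable second moment, e.g. the refined Q-FP-15-7's `f_SX(j)` IF
# that Hessian sits outside `Js`)

HONEST DEPENDENCY (page 1, mandatory): continuum YM on T⁴ ⇐ BetaPertH ∧ nine spine estimates (0/9 proved); BetaPertH ⇐ (D1) ∧ (D4) ∧ CAP+tail;
G-an2-4 gates asym, D1 and NE2/3/4.  HONEST FRAMING (cell contract, verbatim): «discharging `BetaPertH` makes Bałaban's UV stability UNCONDITIONAL —
a real constructive-QFT result; it is NOT the continuum limit and NOT the Clay problem.»  THIS MODULE is [our object] elementary real analysis over the road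
owner's `FixedPointIdentification` ∕ `FP.FixedPointIdentificationSummable` (b2b-balaban-beta-d1-p3 gens 1 ∕ 15); no `def`, no `def … : Prop`, nothing cited,
0 sorry; 0∕4 row-D1 binders; DOORS (hypothesis shapes), not a discharge: NOT SDF, NOT D1, NOT (CONV-C), NEVER «G-an2-4 closed», NOT BetaPertH, NOT continuum,
NOT Clay.  «not in print; our bookkeeping».

ABSOLUTE RULE (cell charter, verbatim): «No internally-minted statement may enter as a cited fact. Every hypothesis is either kernel-proved in this package or a
verbatim quotation of a PUBLISHED theorem with page reference. The manuscript(s) under audit are NOT citable for their own disputed steps — they are the thing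
under adjudication; programme-internal (2001/route/tribunal) claims are never citable.»

WHY (journal: PROPOSED R-FP-47 l.34659 ∕ l.34723 [D1P3-G15-RFP47 ∕ -SUMMABLE], the (CONV-C)-Sb chair's word [G30-RFP47-W1] (concurred by the owner, W-FP-15-3
[D1P3-G15-W3]), and the owner's ERRATUM E-FP-15-3 [D1P3-G15-EFP153] which WITHDRAWS R-FP-47 — (SDF) exact, no Faddeev–Popov residual — while keeping the variable-defect files as
«harmless generalisation» and REFINING Q-FP-15-7 to a per-step addend `f_SX(j)` whose (μ≠ν) second moment is «generically non-zero, not summable in j» IF it sits outside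
`Js`).  Road FP's step law for the one-loop functional on the powers of the blocking factor reads `f (Lc^(m+1)) = f (Lc^m) + f Lc + δ m`.  The owner's two files give the two ends of a dichotomy: a STATIONARY defect
`δ m = δ` shifts the identified value (`FixedPointIdentification.value_eq_of_defected_step_law_bounded`), a defect with BOUNDED PARTIAL SUMS does not
(`FixedPointIdentificationSummable.value_eq_of_summableDefect_step_law_bounded`; door (ii) «GHOST-RG»).  What a one-step RATE row of the (CONV-C) class —
the shape every G-an2-4 supplier proves («the level-m constituent converges GEOMETRICALLY to a named limit») — actually delivers for `δ` is NEITHER end but the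
GEOMETRIC-CAUCHY shape `|δ (m+1) − δ m| ≤ C·θ^m`, `θ < 1`.  THIS FILE settles what that shape gives:
 * §1 `exists_limit_of_geometric`: `δ m → ℓ` with `|δ m − ℓ| ≤ C·θ^m∕(1−θ)`; `sum_abs_sub_limit_le`: the transient is summable, `Σ_{k∈[1,m)} |δ k − ℓ| ≤ C∕(1−θ)²`;
 * §2 **`limit_eq_zero_of_partialSums_bounded`**: under the geometric shape, Σ-BOUNDED PARTIAL SUMS FORCE `ℓ = 0` — door (ii) is the IDENTITY `ℓ = 0` at the limit
   objects plus the rate, never the rate alone; conversely `partialSums_bounded_of_limit_eq_zero`;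
 * §3 **`powdev_shifted_of_geometricDefect`** (THE GEOMETRIC-TRANSIENT DOOR): `|f (Lc^m) − m·(f Lc + ℓ)| ≤ |ℓ| + C∕(1−θ)²` — the bounded-deviation door of
   `FixedPointIdentificationSummable` §2 holds with the SHIFTED slope `f Lc + ℓ`;
 * §4 **`shifted_value_eq_of_geometricDefect_step_law_bounded`**: with the bounded-log asymptotics `|f (Lc^m) − m·s| ≤ C′` the identified value is `f Lc + ℓ = s`
   (`stepBal` reading `shifted_value_eq_stepBal_…`), and **`value_eq_iff_limit_eq_zero`**: `f Lc = s ↔ ℓ = 0` — the owner's dichotomy with the middle filled in;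
 * §5 `oneLoopDrift_shifted_of_rate_geometricDefect_bounded`: composed with road A2's rate (`GeomRate β0 (f Lc) c₀ θ′`), the wall's drift slope is `s − ℓ`
   — «the universal number minus the limiting per-step defect» (Q-FP-15-7's «ghost share» as a typed slot `ℓ`, valued nowhere here);
 * §6 `oneLoopDrift_add` (generic additivity of drift hypotheses — the three-line glue asym1 A-asym1-g92-1 (F2) names as «not in the tree yet»; NOT an asym1
   socket) and `oneLoopDrift_sum_recovers_slope`: an ADDEND family with `GeomRate fadd ℓ c θ` on top of the shifted main family gives the SUM the un-shifted slope `s`.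
Provenance: crux team (2), unit b2b-balaban-gan24-p3 gen 30 (prover-b2b-balaban-gan24-p3-g30-0), road-P3 «fibre∕strip Woodbury» of row G-an2-4, 2026-08-21;
FREEZE (0) honoured (a corollary module over the road owner's objects; no new object).
-/

namespace Summit.QuantumFields.BalabanUV.Beta.FP.FixedPointIdentificationGeometric

open Finset Filter Topology
open Literature.MathematicalPhysics.QuantumFieldTheory.Balaban1983to89
open Literature.MathematicalPhysics.QuantumFieldTheory.Balaban1983to89.Beta.RateCertificate (GeomRate)
open Literature.MathematicalPhysics.QuantumFieldTheory.Balaban1983to89.Beta.Drift (OneLoopDrift)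
open B12Normalization (stepBal)
open Summit.QuantumFields.BalabanUV.Beta.FixedPointIdentification (eq_of_nat_mul_sub_bounded stepBal_natPow oneLoopDrift_of_geomRate_eq)
open Summit.QuantumFields.BalabanUV.Beta.FP.FixedPointIdentificationSummable (closed_form_of_variableDefect_step_law)

/-! ## §1 A geometrically Cauchy defect sequence converges, with a summable transient -/

/-- [our object] the constant of a geometric-Cauchy bound is non-negative (take `m = 0`). -/
theorem const_nonneg_of_geometric {δ : ℕ → ℝ} {C θ : ℝ} (hδ : ∀ m : ℕ, |δ (m + 1) - δ m| ≤ C * θ ^ m) : 0 ≤ C := by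
  have h := hδ 0
  rw [pow_zero, mul_one] at h
  exact (abs_nonneg _).trans h

/-- [our object] **A GEOMETRICALLY CAUCHY SEQUENCE CONVERGES, WITH THE GEOMETRIC TAIL BOUND**: `|δ (m+1) − δ m| ≤ C·θ^m`, `0 ≤ θ < 1` ⟹ there is `ℓ` with
`δ m → ℓ` and `|δ m − ℓ| ≤ C·θ^m∕(1 − θ)` for every `m`.  (Mathlib's `cauchySeq_of_le_geometric` ∕ `dist_le_of_le_geometric_of_tendsto` on `ℝ`.) -/
theorem exists_limit_of_geometric {δ : ℕ → ℝ} {C θ : ℝ} (hθ1 : θ < 1)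
    (hδ : ∀ m : ℕ, |δ (m + 1) - δ m| ≤ C * θ ^ m) :
    ∃ ℓ : ℝ, Tendsto δ atTop (𝓝 ℓ) ∧ ∀ m : ℕ, |δ m - ℓ| ≤ C * θ ^ m / (1 - θ) := by
  have hu : ∀ n : ℕ, dist (δ n) (δ (n + 1)) ≤ C * θ ^ n := fun n => by
    rw [Real.dist_eq, abs_sub_comm]
    exact hδ n
  obtain ⟨ℓ, hℓ⟩ := cauchySeq_tendsto_of_complete (cauchySeq_of_le_geometric θ C hθ1 hu)
  refine ⟨ℓ, hℓ, fun m => ?_⟩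
  have h := dist_le_of_le_geometric_of_tendsto θ C hθ1 hu hℓ m
  rwa [Real.dist_eq] at h

/-- [our object] uniqueness of the limit: any `ℓ′` with `δ m → ℓ′` equals the `ℓ` of `exists_limit_of_geometric`, so the tail bound holds for it. -/
theorem abs_sub_limit_le_of_geometric {δ : ℕ → ℝ} {C θ ℓ : ℝ} (hθ1 : θ < 1)
    (hδ : ∀ m : ℕ, |δ (m + 1) - δ m| ≤ C * θ ^ m) (hℓ : Tendsto δ atTop (𝓝 ℓ)) (m : ℕ) :
    |δ m - ℓ| ≤ C * θ ^ m / (1 - θ) := by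
  obtain ⟨ℓ', hℓ', hb⟩ := exists_limit_of_geometric hθ1 hδ
  have : ℓ = ℓ' := tendsto_nhds_unique hℓ hℓ'
  subst this
  exact hb m

/-- [our object] **THE TRANSIENT IS SUMMABLE**: `Σ_{k ∈ [1, m)} |δ k − ℓ| ≤ C∕(1 − θ)²` for every `m` (`0 ≤ θ < 1`). -/
theorem sum_abs_sub_limit_le {δ : ℕ → ℝ} {C θ ℓ : ℝ} (hθ0 : 0 ≤ θ) (hθ1 : θ < 1)
    (hδ : ∀ m : ℕ, |δ (m + 1) - δ m| ≤ C * θ ^ m) (hℓ : Tendsto δ atTop (𝓝 ℓ)) (m : ℕ) :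
    ∑ k ∈ Finset.Ico 1 m, |δ k - ℓ| ≤ C / (1 - θ) ^ 2 := by
  have hC := const_nonneg_of_geometric hδ
  have h1θ : 0 < 1 - θ := sub_pos.mpr hθ1
  calc ∑ k ∈ Finset.Ico 1 m, |δ k - ℓ|
      ≤ ∑ k ∈ Finset.Ico 1 m, C / (1 - θ) * θ ^ k := by
        refine Finset.sum_le_sum fun k _ => ?_
        have h := abs_sub_limit_le_of_geometric hθ1 hδ hℓ k
        calc |δ k - ℓ| ≤ C * θ ^ k / (1 - θ) := h
          _ = C / (1 - θ) * θ ^ k := by ring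
    _ = C / (1 - θ) * ∑ k ∈ Finset.Ico 1 m, θ ^ k := by rw [Finset.mul_sum]
    _ ≤ C / (1 - θ) * (1 / (1 - θ)) := by
        refine mul_le_mul_of_nonneg_left ?_ (div_nonneg hC h1θ.le)
        have hg := geom_sum_Ico_le_of_lt_one (m := 1) (n := m) hθ0 hθ1
        calc ∑ k ∈ Finset.Ico 1 m, θ ^ k ≤ θ ^ 1 / (1 - θ) := hg
          _ ≤ 1 / (1 - θ) := by
              refine div_le_div_of_nonneg_right ?_ h1θ.le
              rw [pow_one]; exact hθ1.le
    _ = C / (1 - θ) ^ 2 := by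
        field_simp

/-- [our object] the signed transient sum is bounded by the same constant. -/
theorem abs_sum_sub_limit_le {δ : ℕ → ℝ} {C θ ℓ : ℝ} (hθ0 : 0 ≤ θ) (hθ1 : θ < 1)
    (hδ : ∀ m : ℕ, |δ (m + 1) - δ m| ≤ C * θ ^ m) (hℓ : Tendsto δ atTop (𝓝 ℓ)) (m : ℕ) :
    |∑ k ∈ Finset.Ico 1 m, (δ k - ℓ)| ≤ C / (1 - θ) ^ 2 :=
  (Finset.abs_sum_le_sum_abs _ _).trans (sum_abs_sub_limit_le hθ0 hθ1 hδ hℓ m)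

/-- [our object] splitting off the limit: `Σ_{k∈[1,m)} δ k = Σ_{k∈[1,m)} (δ k − ℓ) + (m − 1)·ℓ` for `m ≥ 1`. -/
theorem sum_Ico_eq_sum_sub_add {δ : ℕ → ℝ} (ℓ : ℝ) (m : ℕ) (hm : 1 ≤ m) :
    ∑ k ∈ Finset.Ico 1 m, δ k = ∑ k ∈ Finset.Ico 1 m, (δ k - ℓ) + ((m : ℝ) - 1) * ℓ := by
  rw [Finset.sum_sub_distrib, Finset.sum_const, Nat.card_Ico, nsmul_eq_mul, Nat.cast_sub hm, Nat.cast_one]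
  ring

/-! ## §2 Door (ii) under the geometric shape: Σ-bounded partial sums ⟺ the limit defect vanishes -/

/-- [our object] **Σ-BOUNDED PARTIAL SUMS FORCE THE LIMIT DEFECT TO VANISH**: if `|δ (m+1) − δ m| ≤ C·θ^m` (`0 ≤ θ < 1`), `δ m → ℓ`, and
`|Σ_{k∈[1,m)} δ k| ≤ D` for all `m ≥ 1`, then `ℓ = 0`.  Door (ii) «GHOST-RG» of R-FP-47 is therefore the identity `ℓ = 0` at the LIMIT objects on top of
the rate — no geometric-rate row supplies it by itself. -/
theorem limit_eq_zero_of_partialSums_bounded {δ : ℕ → ℝ} {C θ ℓ D : ℝ} (hθ0 : 0 ≤ θ) (hθ1 : θ < 1)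
    (hδ : ∀ m : ℕ, |δ (m + 1) - δ m| ≤ C * θ ^ m) (hℓ : Tendsto δ atTop (𝓝 ℓ))
    (hsum : ∀ m : ℕ, 1 ≤ m → |∑ k ∈ Finset.Ico 1 m, δ k| ≤ D) : ℓ = 0 := by
  refine eq_of_nat_mul_sub_bounded (C := D + C / (1 - θ) ^ 2) fun m => ?_
  rw [sub_zero]
  have hm : 1 ≤ m + 1 := Nat.le_add_left 1 m
  have h1 := hsum (m + 1) hm
  have h2 := abs_sum_sub_limit_le hθ0 hθ1 hδ hℓ (m + 1)
  rw [sum_Ico_eq_sum_sub_add ℓ (m + 1) hm] at h1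
  have e : (m : ℝ) * ℓ
      = (∑ k ∈ Finset.Ico 1 (m + 1), (δ k - ℓ) + (((m + 1 : ℕ) : ℝ) - 1) * ℓ) - ∑ k ∈ Finset.Ico 1 (m + 1), (δ k - ℓ) := by
    push_cast; ring
  rw [e]
  exact (abs_sub _ _).trans (by linarith)

/-- [our object] the converse: if the limit defect vanishes, the partial sums ARE bounded, by the transient constant `C∕(1−θ)²`. -/
theorem partialSums_bounded_of_limit_eq_zero {δ : ℕ → ℝ} {C θ : ℝ} (hθ0 : 0 ≤ θ) (hθ1 : θ < 1)
    (hδ : ∀ m : ℕ, |δ (m + 1) - δ m| ≤ C * θ ^ m) (h0 : Tendsto δ atTop (𝓝 0)) (m : ℕ) :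
    |∑ k ∈ Finset.Ico 1 m, δ k| ≤ C / (1 - θ) ^ 2 := by
  have h := abs_sum_sub_limit_le hθ0 hθ1 hδ h0 m
  simpa only [sub_zero] using h

/-! ## §3 THE GEOMETRIC-TRANSIENT DOOR: bounded deviation from the power law with the SHIFTED slope `f Lc + ℓ` -/

/-- [our object] **GEOMETRIC-CAUCHY STEP DEFECT ⇒ BOUNDED DEVIATION FROM THE SHIFTED POWER LAW**: `f (Lc^(m+1)) = f (Lc^m) + f Lc + δ m` (`m ≥ 1`),
`|δ (m+1) − δ m| ≤ C·θ^m` (`0 ≤ θ < 1`), `δ m → ℓ` ⟹ `|f (Lc^m) − m·(f Lc + ℓ)| ≤ |ℓ| + C∕(1−θ)²` for every `m ≥ 1`.  Compare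
`FixedPointIdentificationSummable.stepLaw_sum_bounded_of_summableDefect` (slope `f Lc`, needs Σ-bounded defects). -/
theorem powdev_shifted_of_geometricDefect {f : ℕ → ℝ} {δ : ℕ → ℝ} {Lc : ℕ} {C θ ℓ : ℝ} (hθ0 : 0 ≤ θ) (hθ1 : θ < 1)
    (hstep : ∀ m : ℕ, 1 ≤ m → f (Lc ^ (m + 1)) = f (Lc ^ m) + f Lc + δ m)
    (hδ : ∀ m : ℕ, |δ (m + 1) - δ m| ≤ C * θ ^ m) (hℓ : Tendsto δ atTop (𝓝 ℓ)) (m : ℕ) (hm : 1 ≤ m) :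
    |f (Lc ^ m) - (m : ℝ) * (f Lc + ℓ)| ≤ |ℓ| + C / (1 - θ) ^ 2 := by
  have hstep' : ∀ m : ℕ, 1 ≤ m → (fun m => f (Lc ^ m)) (m + 1) = (fun m => f (Lc ^ m)) m + (fun m => f (Lc ^ m)) 1 + δ m := by
    intro m hm
    simp only [pow_one]
    exact hstep m hm
  have hcl := closed_form_of_variableDefect_step_law (g := fun m => f (Lc ^ m)) hstep' m hm
  simp only [pow_one] at hcl
  have h2 := abs_sum_sub_limit_le hθ0 hθ1 hδ hℓ m
  rw [hcl, sum_Ico_eq_sum_sub_add ℓ m hm]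
  have e : (m : ℝ) * f Lc + (∑ k ∈ Finset.Ico 1 m, (δ k - ℓ) + ((m : ℝ) - 1) * ℓ) - (m : ℝ) * (f Lc + ℓ)
      = ∑ k ∈ Finset.Ico 1 m, (δ k - ℓ) - ℓ := by ring
  rw [e]
  calc |∑ k ∈ Finset.Ico 1 m, (δ k - ℓ) - ℓ| ≤ |∑ k ∈ Finset.Ico 1 m, (δ k - ℓ)| + |ℓ| := abs_sub _ _
    _ ≤ |ℓ| + C / (1 - θ) ^ 2 := by linarith

/-! ## §4 The identified value is SHIFTED BY EXACTLY THE LIMIT DEFECT; the owner's dichotomy with the middle filled in -/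

/-- [our object] **GEOMETRIC-CAUCHY STEP DEFECT + BOUNDED-LOG ASYMPTOTICS ⇒ THE SHIFTED VALUE**: with `|f (Lc^m) − m·s| ≤ C′` for `m ≥ 1` on top of §3's
hypotheses, `f Lc + ℓ = s`.  The two files of the road owner are the cases `δ ≡ ℓ` (stationary: `f Lc = s − ℓ`) and `ℓ = 0` with Σ-bounded sums (`f Lc = s`). -/
theorem shifted_value_eq_of_geometricDefect_step_law_bounded {f : ℕ → ℝ} {δ : ℕ → ℝ} {Lc : ℕ} {C θ ℓ s C' : ℝ} (hθ0 : 0 ≤ θ) (hθ1 : θ < 1)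
    (hstep : ∀ m : ℕ, 1 ≤ m → f (Lc ^ (m + 1)) = f (Lc ^ m) + f Lc + δ m)
    (hδ : ∀ m : ℕ, |δ (m + 1) - δ m| ≤ C * θ ^ m) (hℓ : Tendsto δ atTop (𝓝 ℓ))
    (hasym : ∀ m : ℕ, 1 ≤ m → |f (Lc ^ m) - (m : ℝ) * s| ≤ C') : f Lc + ℓ = s := by
  refine eq_of_nat_mul_sub_bounded (C := max (C' + (|ℓ| + C / (1 - θ) ^ 2)) 0) fun m => ?_
  rcases Nat.eq_zero_or_pos m with h0 | hpos
  · subst h0; simp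
  · have h1 := hasym m hpos
    have h2 := powdev_shifted_of_geometricDefect hθ0 hθ1 hstep hδ hℓ m hpos
    have e : (m : ℝ) * (f Lc + ℓ - s) = (f (Lc ^ m) - (m : ℝ) * s) - (f (Lc ^ m) - (m : ℝ) * (f Lc + ℓ)) := by ring
    rw [e]
    exact ((abs_sub _ _).trans (by linarith [h1, h2])).trans (le_max_left _ _)

/-- [our object] The `stepBal` reading: the bounded-log asymptotics `|f (Lc^m) − stepBal N (Lc^m)| ≤ C′` identify `f Lc + ℓ = stepBal N Lc` — the one-step value is
the universal number MINUS the limiting step defect, `f Lc = stepBal N Lc − ℓ`. -/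
theorem shifted_value_eq_stepBal_of_geometricDefect_step_law_bounded {f : ℕ → ℝ} {δ : ℕ → ℝ} {Lc : ℕ} {C θ ℓ N C' : ℝ} (hθ0 : 0 ≤ θ) (hθ1 : θ < 1)
    (hstep : ∀ m : ℕ, 1 ≤ m → f (Lc ^ (m + 1)) = f (Lc ^ m) + f Lc + δ m)
    (hδ : ∀ m : ℕ, |δ (m + 1) - δ m| ≤ C * θ ^ m) (hℓ : Tendsto δ atTop (𝓝 ℓ))
    (hasym : ∀ m : ℕ, 1 ≤ m → |f (Lc ^ m) - stepBal N ((Lc : ℝ) ^ m)| ≤ C') : f Lc = stepBal N Lc - ℓ := by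
  have h := shifted_value_eq_of_geometricDefect_step_law_bounded (s := stepBal N Lc) hθ0 hθ1 hstep hδ hℓ
    (fun m hm => by rw [← stepBal_natPow]; exact hasym m hm)
  linarith

/-- [our object] **THE DICHOTOMY, MIDDLE FILLED IN**: under a geometric-Cauchy step defect with limit `ℓ` and the bounded-log asymptotics at slope `s`,
the un-shifted identification `f Lc = s` holds IF AND ONLY IF `ℓ = 0`. -/
theorem value_eq_iff_limit_eq_zero {f : ℕ → ℝ} {δ : ℕ → ℝ} {Lc : ℕ} {C θ ℓ s C' : ℝ} (hθ0 : 0 ≤ θ) (hθ1 : θ < 1)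
    (hstep : ∀ m : ℕ, 1 ≤ m → f (Lc ^ (m + 1)) = f (Lc ^ m) + f Lc + δ m)
    (hδ : ∀ m : ℕ, |δ (m + 1) - δ m| ≤ C * θ ^ m) (hℓ : Tendsto δ atTop (𝓝 ℓ))
    (hasym : ∀ m : ℕ, 1 ≤ m → |f (Lc ^ m) - (m : ℝ) * s| ≤ C') : f Lc = s ↔ ℓ = 0 := by
  have h := shifted_value_eq_of_geometricDefect_step_law_bounded hθ0 hθ1 hstep hδ hℓ hasym
  constructor
  · intro hf; linarith
  · intro h0; rw [h0, add_zero] at h; exact h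

/-! ## §5 Composed with road A2's rate: the wall's drift slope is the shifted value -/

/-- [our object] **ROAD «FP», COMPOSED, GEOMETRIC-DEFECT FORM**: geometric rate of the actual coefficients `β0 j` to `f Lc` (`GeomRate β0 (f Lc) c₀ θ′`, road A2) ∧ a
geometric-Cauchy step defect with limit `ℓ` ∧ bounded-log asymptotics `|f (Lc^m) − stepBal N (Lc^m)| ≤ C′` ⟹ `OneLoopDrift (stepBal N Lc − ℓ) (c₀∕(1−θ′)) β0` — the
drift the wall reads has slope `stepBal N Lc − ℓ`; it is `stepBal N Lc` exactly when the limiting step defect vanishes.  Hypotheses only; discharges nothing;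
`ℓ` is a typed slot valued nowhere in this file. -/
theorem oneLoopDrift_shifted_of_rate_geometricDefect_bounded {β0 : ℕ → ℝ} {f : ℕ → ℝ} {δ : ℕ → ℝ} {Lc : ℕ} {N c₀ θ' C θ ℓ C' : ℝ}
    (hrate : GeomRate β0 (f Lc) c₀ θ') (hθ'0 : 0 ≤ θ') (hθ'1 : θ' < 1) (hθ0 : 0 ≤ θ) (hθ1 : θ < 1)
    (hstep : ∀ m : ℕ, 1 ≤ m → f (Lc ^ (m + 1)) = f (Lc ^ m) + f Lc + δ m)
    (hδ : ∀ m : ℕ, |δ (m + 1) - δ m| ≤ C * θ ^ m) (hℓ : Tendsto δ atTop (𝓝 ℓ))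
    (hasym : ∀ m : ℕ, 1 ≤ m → |f (Lc ^ m) - stepBal N ((Lc : ℝ) ^ m)| ≤ C') :
    OneLoopDrift (stepBal N Lc - ℓ) (c₀ / (1 - θ')) β0 :=
  oneLoopDrift_of_geomRate_eq hrate hθ'0 hθ'1 (shifted_value_eq_stepBal_of_geometricDefect_step_law_bounded hθ0 hθ1 hstep hδ hℓ hasym)

/-! ## §6 Two-family glue: an ADDEND family whose coefficients converge geometrically to `ℓ` restores the un-shifted slope for the SUM -/

/-- [our object] **ADDITIVITY OF DRIFT HYPOTHESES** (generic; the three-line glue named in asym1's A-asym1-g92-1 (F2), not an asym1 socket):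
`OneLoopDrift b₁ A₁ β₁ → OneLoopDrift b₂ A₂ β₂ → OneLoopDrift (b₁ + b₂) (A₁ + A₂) (β₁ + β₂)`. -/
theorem oneLoopDrift_add {b₁ b₂ A₁ A₂ : ℝ} {β₁ β₂ : ℕ → ℝ} (h₁ : OneLoopDrift b₁ A₁ β₁) (h₂ : OneLoopDrift b₂ A₂ β₂) :
    OneLoopDrift (b₁ + b₂) (A₁ + A₂) (fun j => β₁ j + β₂ j) := by
  intro k
  have e : ∑ j ∈ Finset.range k, (β₁ j + β₂ j) - (b₁ + b₂) * (k : ℝ)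
      = (∑ j ∈ Finset.range k, β₁ j - b₁ * (k : ℝ)) + (∑ j ∈ Finset.range k, β₂ j - b₂ * (k : ℝ)) := by
    rw [Finset.sum_add_distrib]; ring
  show |∑ j ∈ Finset.range k, (β₁ j + β₂ j) - (b₁ + b₂) * (k : ℝ)| ≤ A₁ + A₂
  rw [e]
  exact (abs_add_le _ _).trans (add_le_add (h₁ k) (h₂ k))

/-- [our object] **THE ADDEND DOOR CLOSES ON THE SUM FAMILY**: if the main coefficient family drifts with the SHIFTED slope `s − ℓ` (§5) and the addend's coefficients
`fadd j` converge geometrically to `ℓ` (`GeomRate fadd ℓ c θ`), then the SUM family `β0 j + fadd j` drifts with the un-shifted slope `s`.  (With `s = stepBal N Lc`: the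
universal number is carried by the sum of the two families, by neither alone.)  Hypotheses only. -/
theorem oneLoopDrift_sum_recovers_slope {β0 fadd : ℕ → ℝ} {s ℓ A c θ : ℝ} (hmain : OneLoopDrift (s - ℓ) A β0)
    (hadd : GeomRate fadd ℓ c θ) (hθ0 : 0 ≤ θ) (hθ1 : θ < 1) :
    OneLoopDrift s (A + c / (1 - θ)) (fun j => β0 j + fadd j) := by
  have h := oneLoopDrift_add hmain (hadd.drift hθ0 hθ1)
  simpa only [sub_add_cancel] using h

end Summit.QuantumFields.BalabanUV.Beta.FP.FixedPointIdentificationGeometric
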